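import Mathlib.Topology.Instances.AddCircle.Defs
import Mathlib.Analysis.Normed.Group.AddCircle
import Mathlib.Analysis.Normed.Group.Quotient
import Mathlib.Algebra.Order.Round
import Mathlib.Algebra.BigOperators.Finsupp.Basic
import Mathlib.Algebra.BigOperators.Field
import Literature.NumberTheory.ConnesConsani2023.RiemannRochSpecZ
import Literature.NumberTheory.ConnesConsani2023.RiemannRochSpecZProofs
import HarnessLib

/-!
# Connes–Consani, Riemann–Roch for `Spec ℤ̄` (2023) — Theorem 5.3 = Theorem 1.2 (Serre duality), PROVED

A. Connes, C. Consani, *Riemann–Roch for `\overline{Spec ℤ}`*, Bull. Sci. Math. 187 (2023) 103293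
(= arXiv:2205.01391) [bib: `ConnesConsani2023RiemannRoch`], §5 "Duality".  The second main theorem of
the paper (Thm. 1.2 p. 4 = Thm. 5.3 p. 12): "Let `D = Σ_j a_j{p_j} + a{∞}` be an Arakelov divisor on
`\overline{Spec ℤ}`.  There is a canonical isomorphism of `𝕊[±1]`-modules
`H⁰(K − D) ≃ Hom_{Γ𝒯*}(H¹(D), U(1)_{1/4})`, where `K` is the divisor `K = −2{2}`."  Cell `pub-rhdoor`
(motivic door), seat cc-2; typed in the vocabulary of `RiemannRochSpecZ.lean` (no parallel vocabulary)
and PROVED following the printed proof (Prop. 5.2 + proof of Thm. 5.3, pp. 12–13).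

## How the two sides are typed (level by level)

Both sides are sub-`𝕊[±1]`-modules of Eilenberg–MacLane `Γ`-sets, so they are determined by their
values on the pointed sets `k_+`, `k ∈ ℕ` (functoriality is by summing over fibres, §2 p. 5):
* `H⁰(E)(k_+) = ‖HL_E‖_{e^{b}}(k_+)` = "the pointed set of `L_E`-valued divisors on `k_+` vanishing on
  the base point and whose total mass `Σ |φ(x)|` is bounded by `e^{b}`" (§2 p. 5; Prop. 2.2 (i)), for
  `E = Σ b_j{p_j} + b{∞}` with lattice `L_E = (Π p_j^{-b_j})ℤ` — `H0Level E k` below;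
* `Hom_{Γ𝒯*}((A,d)_λ, U(1)_μ)(k_+)` "is given by k-tuples `(χ_j)`, `1 ≤ j ≤ k` of [continuous]
  characters `χ_j ∈ Â` such that … for all finite collections `{x_i} ⊂ A`,
  `Σ_i |x_i| ≤ λ ⇒ Σ_{i,j} |χ_j(x_i)| ≤ μ`" — this is PROPOSITION 5.2 (i) (p. 12), proved in print from
  the full faithfulness of `H` on abelian groups; its proof also shows that the tolerance condition
  FORCES (uniform) continuity, so "character" may be read as "group homomorphism `A → ℝ/ℤ`".  We TYPE
  the level-`k` Hom-set by this printed description — `IsTolHom` below — for `A = H¹(D) = (ℝ/L, d)_{e^a}`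
  (Prop. 6.5 (ii); Mathlib `AddCircle (gen D)` with its quotient norm = "the canonical metric of
  length" `gen D`; `U(1) = ℝ/ℤ` = `AddCircle 1` with the metric of length 1, §5.2 p. 12).
* The identification.  For `y ∈ L_{K−D} = (4/m)ℤ` (`m = gen D`, since `K = −2{2}` contributes `2² = 4`)
  the character `χ_y(x) := x·y/4` of `ℝ/mℤ` is well defined (`m·y/4 ∈ ℤ`); in the paper's reduced case
  `L = ℤ` this is `χ_n(s) = n s` with `y = 4n` ("`Â = ℤ` and the characters `χ_n` are given by
  multiplication by `n`", proof of Thm. 5.3) — `dualChar` below.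

THEOREM 5.3, level `k` (`serreDuality_level`, PROVED): a `k`-tuple `(χ_j)` of homomorphisms
`ℝ/L_D ℤ → ℝ/ℤ` satisfies the tolerance condition of `Hom_{Γ𝒯*}(H¹(D), U(1)_{1/4})(k_+)` IF AND ONLY IF
`χ_j = χ_{y_j}` for a (unique, `dualChar_injOn`) `(y_j) ∈ H⁰(K − D)(k_+)`, i.e. `y_j ∈ L_{K−D}` and
`Σ_j |y_j| ≤ e^{deg_∞(K − D)} = e^{−a}`.  Packaged as a bijection `serreDualityEquiv D k :
H0Level (K − D) k ≃ {χ // IsTolHom e^a (1/4) χ}` and as the named statement `SerreDuality_SpecZbar` with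
`SerreDuality_SpecZbar_holds`.

## Proof (as printed, pp. 12–13, made quantitative)

(1) Every homomorphism `χ : ℝ/mℤ → ℝ/ℤ` obeying the tolerance inequality is `x ↦ n x/m` for an
integer `n` (`exists_int_of_tol`): the printed proof quotes `\widehat{ℝ/ℤ} = ℤ`; we prove what is
needed directly — the tolerance inequality with `M` equal entries gives `|χ(t)| ≤ μ/M` for `|t| ≤ λ/M`,
so the representative `ℓ(t) ∈ [−1/2, 1/2)` of `χ(t)` is additive for `|s|,|t|,|s+t| ≤ λ`
(an integer of absolute value `≤ 3/4` vanishes) and `|ℓ(t)| ≤ μ/M` for `|t| ≤ λ/M`; a squeeze over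
`N → ∞` on the grid `(λ/2)/N` gives `ℓ(t) = c t` on `[−λ/2, λ/2]`, additivity extends `χ(t) = c t
(mod 1)` to all `t`, and `χ(m) = 0` forces `c m ∈ ℤ`.  (2) For `χ_j(x) = n_j x/m`: "Assume that
`Σ_j |n_j| ≤ m/(4λ)`, then [the tolerance inequality] follows since `d(n x, 0) ≤ |n| d(x, 0)`.
Conversely … repeating `M` times the same `x` … Taking `M` large enough and `x = λ/M` one obtains
`Σ_j |n_j| x ≤ 1/(4M)`, and hence `Σ_j |n_j| ≤ m/(4λ)`" (p. 12 L60 – p. 13 L5, with `L = mℤ` instead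
of the reduction to `L = ℤ`).  (3) `y_j := 4 n_j/m ∈ (4/m)ℤ = L_{K−D}` and
`Σ|y_j| ≤ e^{−a} ⟺ Σ|n_j| ≤ m e^{−a}/4 = m/(4λ)`, `λ = e^a`.

Also PROVED here: the symmetric reading `H⁰(D) ≃ Hom(H¹(K − D), U(1)_{1/4})` displayed at the head
of §5 (`serreDuality_level'`, via `K − (K − D) = D`) and the remark "One has
`dim_{𝕊[±1]}(U(1)_{1/4}) = 1`" (§5 p. 11; `pmTolDim_U1_quarter`, from Prop. 4.1 = `dim_U1_eq_holds` with
`⌈log 2/log 3⌉ = 1`).  Deliberately NOT typed: the internal-Hom functor `Hom_{Γ𝒯*}` as an object of `Γ𝒯*` (Lemma 6.1) and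
Prop. 5.2 (ii) (pull-back invariance) — we work at each level `k_+` with Prop. 5.2 (i)'s description.
-/

noncomputable section

open Set

namespace Literature.NumberTheory.ConnesConsani2023

/-! ## The canonical divisor `K = −2{2}` and differences of divisors -/

namespace ArakelovDivisor

/-- Difference of Arakelov divisors, coefficientwise (divisors form an abelian group, §2 p. 5).
[cite: ConnesConsani2023RiemannRoch, §2 p. 5] -/
def sub (D E : ArakelovDivisor) : ArakelovDivisor where
  fin := D.fin - E.fin
  prime_of_mem_support := fun p hp => by
    have h := Finsupp.support_sub hp
    rcases Finset.mem_union.mp h with h | h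
    · exact D.prime_of_mem_support p h
    · exact E.prime_of_mem_support p h
  inf := D.inf - E.inf

/-- `(D − E)_∞ = a_D − a_E` (coefficientwise difference). [cite: ConnesConsani2023RiemannRoch, §2 p. 5] -/
@[simp] theorem inf_sub (D E : ArakelovDivisor) : (D.sub E).inf = D.inf - E.inf := rfl

/-- `(D − E)_p = (a_D)_p − (a_E)_p` (coefficientwise difference). [cite: ConnesConsani2023RiemannRoch, §2 p. 5] -/
@[simp] theorem fin_sub (D E : ArakelovDivisor) : (D.sub E).fin = D.fin - E.fin := rfl

/-- The lattice generator is multiplicative in `−D`: `gen(D − E) = gen D / gen E`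
(`Π p^{-(d_p − e_p)} = Π p^{-d_p} / Π p^{-e_p}`). [cite: ConnesConsani2023RiemannRoch, Prop. 6.5 p. 15] -/
theorem gen_sub (D E : ArakelovDivisor) : (D.sub E).gen = D.gen / E.gen := by
  classical
  unfold gen
  rw [fin_sub, sub_eq_add_neg]
  have hprime : ∀ p ∈ D.fin.support ∪ (-E.fin).support, (p : ℝ) ≠ 0 := by
    intro p hp
    rcases Finset.mem_union.mp hp with h | h
    · exact_mod_cast (D.prime_of_mem_support p h).ne_zero
    · rw [Finsupp.support_neg] at h
      exact_mod_cast (E.prime_of_mem_support p h).ne_zero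
  rw [Finsupp.prod_add_index (f := D.fin) (g := -E.fin)
    (h := fun (p : ℕ) (a : ℤ) => (p : ℝ) ^ (-a)) (fun p _ => by simp)
    (fun p hp b₁ b₂ => by rw [neg_add, zpow_add₀ (hprime p hp)])]
  rw [Finsupp.prod_neg_index (g := E.fin) (h := fun (p : ℕ) (a : ℤ) => (p : ℝ) ^ (-a))
    (fun a => by simp)]
  simp only [neg_neg, div_eq_mul_inv]
  congr 1
  rw [Finsupp.prod, Finsupp.prod, ← Finset.prod_inv_distrib]
  refine Finset.prod_congr rfl fun p _ => ?_
  rw [zpow_neg, inv_inv]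

end ArakelovDivisor

/-- The **canonical divisor** `K := −2{2}` of `\overline{Spec ℤ}` ("plays the role of the canonical
divisor", §5 p. 11; Thm. 5.3 p. 12; `deg K = −2 log 2`). [cite: ConnesConsani2023RiemannRoch, Thm. 5.3 p. 12] -/
def canonicalDivisor : ArakelovDivisor where
  fin := Finsupp.single 2 (-2)
  prime_of_mem_support := fun p hp => by
    have h := Finsupp.support_single_subset hp
    rw [Finset.mem_singleton] at h
    subst h
    exact Nat.prime_two
  inf := 0

/-- `gen K = 2² = 4` (`𝒪(K)_2 = 2^{2} ℤ_2`). [cite: ConnesConsani2023RiemannRoch, Thm. 5.3 p. 12] -/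
theorem gen_canonicalDivisor : canonicalDivisor.gen = 4 := by
  unfold ArakelovDivisor.gen canonicalDivisor
  rw [Finsupp.prod_single_index (by simp)]
  norm_num

/-- `deg K = −2 log 2` (Intro p. 4: "K = −2{2}"; `deg` with natural logarithms).
[cite: ConnesConsani2023RiemannRoch, Thm. 1.2 p. 4] -/
theorem deg_canonicalDivisor : canonicalDivisor.deg = -2 * Real.log 2 := by
  unfold ArakelovDivisor.deg canonicalDivisor
  rw [Finsupp.sum_single_index (by simp)]
  push_cast
  ring

/-- `gen (K − D) = 4 / gen D`: the lattice of `K − D` is `L_{K−D} = (4/m)ℤ` for `L_D = mℤ`.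
[cite: ConnesConsani2023RiemannRoch, Thm. 5.3 p. 12] -/
theorem gen_canonical_sub (D : ArakelovDivisor) : (canonicalDivisor.sub D).gen = 4 / D.gen := by
  rw [ArakelovDivisor.gen_sub, gen_canonicalDivisor]

/-- `(K − D)_∞ = −a` (`K = −2{2}` has no archimedean part). [cite: ConnesConsani2023RiemannRoch, Thm. 5.3 p. 12] -/
theorem inf_canonical_sub (D : ArakelovDivisor) : (canonicalDivisor.sub D).inf = -D.inf := by
  simp [canonicalDivisor]

/-- Membership in `L_{K−D} = (4/gen D)ℤ`. [cite: ConnesConsani2023RiemannRoch, Thm. 5.3 p. 12] -/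
theorem mem_lattice_canonical_sub (D : ArakelovDivisor) (y : ℝ) :
    y ∈ (canonicalDivisor.sub D).lattice ↔ ∃ n : ℤ, y = n * (4 / D.gen) := by
  simp [ArakelovDivisor.lattice, gen_canonical_sub]

/-- `K − (K − D) = D` (so Theorem 5.3 can be read both ways, as at the head of §5 p. 11).
[cite: ConnesConsani2023RiemannRoch, §5 p. 11] -/
theorem canonical_sub_canonical_sub (D : ArakelovDivisor) :
    canonicalDivisor.sub (canonicalDivisor.sub D) = D := by
  cases D with
  | mk fin h inf => simp [ArakelovDivisor.sub, canonicalDivisor, sub_sub_cancel]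

/-! ## Level-`k` pieces of the two sides -/

/-- `H⁰(D)(k_+) = ‖HL‖_{e^a}(k_+)`: the `L`-valued divisors `y` on the pointed set `k_+` (i.e. `k`-tuples,
the base point carrying `0`) of total mass `Σ_j |y_j| ≤ e^a` (§2 p. 5 display; Prop. 2.2 (i) p. 6).  At
`k = 1` this is `H0set` (`mem_H0Level_one_iff`). [cite: ConnesConsani2023RiemannRoch, §2 p. 5; Prop. 2.2 (i) p. 6] -/
def H0Level (D : ArakelovDivisor) (k : ℕ) : Set (Fin k → ℝ) :=
  {y | (∀ j, y j ∈ D.lattice) ∧ ∑ j, |y j| ≤ Real.exp D.inf}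

/-- Level `1_+` of `H⁰(D)` is the finite set `H0set D = {x ∈ L : |x| ≤ e^a}` of `RiemannRochSpecZ`.
[cite: ConnesConsani2023RiemannRoch, Prop. 2.2 (i) p. 6] -/
theorem mem_H0Level_one_iff (D : ArakelovDivisor) (y : Fin 1 → ℝ) :
    y ∈ H0Level D 1 ↔ y 0 ∈ D.H0set := by
  simp [H0Level, ArakelovDivisor.H0set, Fin.forall_fin_one]

/-- **Proposition 5.2 (i), taken as the typed description of `Hom_{Γ𝒯*}((A,d)_λ, U(1)_μ)(k_+)`**
(p. 12): a `k`-tuple `(χ_j)` of homomorphisms `A → U(1) = ℝ/ℤ` such that for every finite collection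
`(x_i)` in `A` (repetitions allowed, as used in the proof: "repeating `m` times the same `x`"),
`Σ_i |x_i| ≤ λ ⇒ Σ_{i,j} |χ_j(x_i)| ≤ μ`, where `|x| := d(x, 0)` (here: the norm of the seminormed group
`A`, and on `ℝ/ℤ = AddCircle 1` the quotient norm = the canonical metric of length 1).  Continuity of the
`χ_j` is a consequence (proof of Prop. 5.2 (i)), not an extra hypothesis.
[cite: ConnesConsani2023RiemannRoch, Prop. 5.2 (i) p. 12] -/
def IsTolHom {A : Type*} [SeminormedAddCommGroup A] (lam mu : ℝ) {k : ℕ}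
    (χ : Fin k → (A →+ AddCircle (1 : ℝ))) : Prop :=
  ∀ (l : ℕ) (x : Fin l → A), ∑ i, ‖x i‖ ≤ lam → ∑ i, ∑ j, ‖χ j (x i)‖ ≤ mu

/-- The basic character `χ₁ : ℝ/mℤ → ℝ/ℤ`, `x ↦ x/m` (`m = gen D`), i.e. the generator of
`\widehat{ℝ/L} ≅ ℤ` (proof of Thm. 5.3: "`Â = ℤ` and the characters `χ_n ∈ Â` are given by multiplication
by `n`"). Mathlib's `AddCircle.equivAddCircle`. [cite: ConnesConsani2023RiemannRoch, proof of Thm. 5.3 p. 12] -/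
def baseChar (D : ArakelovDivisor) : AddCircle D.gen →+ AddCircle (1 : ℝ) :=
  (AddCircle.equivAddCircle D.gen 1 D.gen_pos.ne' one_ne_zero).toAddMonoidHom

/-- `χ₁(x) = x/m`. [cite: ConnesConsani2023RiemannRoch, proof of Thm. 5.3 p. 12] -/
theorem baseChar_apply_coe (D : ArakelovDivisor) (x : ℝ) :
    baseChar D (x : AddCircle D.gen) = ((x / D.gen : ℝ) : AddCircle (1 : ℝ)) := by
  simp [baseChar, div_eq_mul_inv]

/-- The character of `H¹(D) = ℝ/L_D` attached to `y ∈ L_{K−D} = (4/m)ℤ`: `χ_y := (m y/4)·χ₁`, i.e.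
`χ_y(x) = x y/4` (`dualChar_apply_coe`); for `L_D = ℤ` and `y = 4n` this is the paper's `χ_n(s) = n s`.
(Off the lattice the integer `m y/4` is replaced by its rounding — a junk value never used.)
[cite: ConnesConsani2023RiemannRoch, proof of Thm. 5.3 p. 12] -/
def dualChar (D : ArakelovDivisor) (y : ℝ) : AddCircle D.gen →+ AddCircle (1 : ℝ) :=
  (zsmulAddGroupHom (round (y * D.gen / 4))).comp (baseChar D)

/-- `χ_y = (m y/4)·χ₁` pointwise. [cite: ConnesConsani2023RiemannRoch, proof of Thm. 5.3 p. 12] -/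
theorem dualChar_apply (D : ArakelovDivisor) (y : ℝ) (z : AddCircle D.gen) :
    dualChar D y z = round (y * D.gen / 4) • baseChar D z := rfl

/-- For `y = n·(4/m) ∈ L_{K−D}` the integer `m y/4` is `n`. [folklore] -/
private theorem round_of_mem_lattice {D : ArakelovDivisor} {y : ℝ} {n : ℤ}
    (hy : y = n * (4 / D.gen)) : round (y * D.gen / 4) = n := by
  have hm : D.gen ≠ 0 := D.gen_pos.ne'
  have : y * D.gen / 4 = n := by rw [hy]; field_simp
  rw [this, round_intCast]

/-- `χ_y(x) = x·y/4 (mod 1)` for `y ∈ L_{K−D}`. [cite: ConnesConsani2023RiemannRoch, proof of Thm. 5.3 p. 12] -/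
theorem dualChar_apply_coe {D : ArakelovDivisor} {y : ℝ}
    (hy : y ∈ (canonicalDivisor.sub D).lattice) (x : ℝ) :
    dualChar D y (x : AddCircle D.gen) = ((x * y / 4 : ℝ) : AddCircle (1 : ℝ)) := by
  obtain ⟨n, hn⟩ := (mem_lattice_canonical_sub D y).mp hy
  have hm : D.gen ≠ 0 := D.gen_pos.ne'
  rw [dualChar_apply, round_of_mem_lattice hn, baseChar_apply_coe, ← AddCircle.coe_zsmul]
  congr 1
  rw [hn, zsmul_eq_mul]
  field_simp

/-! ## Elementary facts on `ℝ/pℤ` with its length-`p` metric -/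

/-- `‖x mod p‖ ≤ |x|`. [folklore] -/
private theorem norm_coe_le_abs (p x : ℝ) : ‖(x : AddCircle p)‖ ≤ |x| := by
  have h := QuotientAddGroup.norm_mk_le_norm (S := AddSubgroup.zmultiples p) (m := x)
  rwa [Real.norm_eq_abs] at h

/-- Every class of `ℝ/pℤ` (`p > 0`) has a representative `r` with `|r| = ‖class‖` (and `|r| ≤ p/2`).
[folklore] -/
private theorem exists_rep {p : ℝ} (hp : 0 < p) (z : AddCircle p) :
    ∃ r : ℝ, (r : AddCircle p) = z ∧ ‖z‖ = |r| ∧ |r| ≤ p / 2 := by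
  haveI : Fact (0 < p) := ⟨hp⟩
  set r : ℝ := (AddCircle.equivIco p (-(p / 2)) z : ℝ) with hr
  have hz : (r : AddCircle p) = z := AddCircle.coe_equivIco
  have hmem := (AddCircle.equivIco p (-(p / 2)) z).2
  have habs : |r| ≤ p / 2 := by
    rw [abs_le]; constructor <;> linarith [hmem.1, hmem.2]
  refine ⟨r, hz, ?_, habs⟩
  rw [← hz, AddCircle.norm_coe_eq_abs_iff p hp.ne', abs_of_pos hp]
  exact habs

/-- A real number whose class in `ℝ/ℤ` vanishes and whose absolute value is `< 1` is `0`. [folklore] -/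
private theorem eq_zero_of_coe_eq_zero_of_abs_lt_one {r : ℝ} (h : (r : AddCircle (1 : ℝ)) = 0)
    (hr : |r| < 1) : r = 0 := by
  obtain ⟨n, hn⟩ := (AddCircle.coe_eq_zero_iff (1 : ℝ)).mp h
  rw [zsmul_eq_mul, mul_one] at hn
  rw [← hn] at hr ⊢
  have : |(n : ℝ)| < 1 := hr
  rw [← Int.cast_abs] at this
  have hn0 : |n| < 1 := by exact_mod_cast this
  have : n = 0 := Int.abs_lt_one_iff.mp hn0
  simp [this]

/-! ## Step 1: the representative `ℓ ∈ [−1/2, 1/2)` of a class of `ℝ/ℤ`, and its additivity on small classes -/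

/-- `0 < 1`, as a `Fact` for `AddCircle.equivIco` on `ℝ/ℤ`. [folklore] -/
private instance factZeroLtOneReal : Fact ((0 : ℝ) < 1) := ⟨one_pos⟩

/-- The representative of a class of `ℝ/ℤ` in `[−1/2, 1/2)`. [folklore] -/
private def lift1 (z : AddCircle (1 : ℝ)) : ℝ :=
  (AddCircle.equivIco (1 : ℝ) (-(1 / 2)) z : ℝ)

/-- The representative maps back to the class. [folklore] -/
private theorem coe_lift1 (z : AddCircle (1 : ℝ)) : (lift1 z : AddCircle (1 : ℝ)) = z :=
  AddCircle.coe_equivIco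

/-- `|ℓ| ≤ 1/2`. [folklore] -/
private theorem abs_lift1_le (z : AddCircle (1 : ℝ)) : |lift1 z| ≤ 1 / 2 := by
  have hmem := (AddCircle.equivIco (1 : ℝ) (-(1 / 2)) z).2
  simp only [lift1]
  rw [abs_le]
  constructor <;> [linarith [hmem.1]; linarith [hmem.2]]

/-- `‖z‖ = |representative|`. [folklore] -/
private theorem norm_eq_abs_lift1 (z : AddCircle (1 : ℝ)) : ‖z‖ = |lift1 z| := by
  conv_lhs => rw [← coe_lift1 z]
  rw [AddCircle.norm_coe_eq_abs_iff (1 : ℝ) one_ne_zero, abs_one]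
  exact abs_lift1_le z

/-- The representative of `0` is `0`. [folklore] -/
private theorem lift1_zero : lift1 0 = 0 := by
  have h := norm_eq_abs_lift1 0
  rw [norm_zero] at h
  exact abs_eq_zero.mp h.symm

/-- If `z₁`, `z₂`, `z₁ + z₂` all have norm `≤ 1/4` in `ℝ/ℤ`, their representatives add (an integer of
absolute value `≤ 3/4` vanishes). [folklore] -/
private theorem lift1_add_of_small {z₁ z₂ : AddCircle (1 : ℝ)} (h₁ : ‖z₁‖ ≤ 1 / 4) (h₂ : ‖z₂‖ ≤ 1 / 4)
    (h₁₂ : ‖z₁ + z₂‖ ≤ 1 / 4) : lift1 (z₁ + z₂) = lift1 z₁ + lift1 z₂ := by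
  have hr : ((lift1 z₁ + lift1 z₂ - lift1 (z₁ + z₂) : ℝ) : AddCircle (1 : ℝ)) = 0 := by
    rw [AddCircle.coe_sub, AddCircle.coe_add, coe_lift1, coe_lift1, coe_lift1, sub_self]
  rw [norm_eq_abs_lift1] at h₁ h₂ h₁₂
  have habs : |lift1 z₁ + lift1 z₂ - lift1 (z₁ + z₂)| < 1 := by
    calc |lift1 z₁ + lift1 z₂ - lift1 (z₁ + z₂)|
        ≤ |lift1 z₁ + lift1 z₂| + |lift1 (z₁ + z₂)| := abs_sub _ _
      _ ≤ |lift1 z₁| + |lift1 z₂| + |lift1 (z₁ + z₂)| := by gcongr; exact abs_add_le _ _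
      _ < 1 := by linarith
  have := eq_zero_of_coe_eq_zero_of_abs_lt_one hr habs
  linarith

/-- Squeeze: a real number bounded by `K/N` for every `N ≥ 1` vanishes. [folklore] -/
private theorem eq_zero_of_abs_le_div_nat {a K : ℝ} (h : ∀ N : ℕ, 1 ≤ N → |a| ≤ K / N) : a = 0 := by
  by_contra ha
  have ha' : 0 < |a| := abs_pos.mpr ha
  obtain ⟨N, hN⟩ := exists_nat_gt (K / |a|)
  have hN1 : 1 ≤ N + 1 := Nat.le_add_left 1 N
  have hNpos : (0 : ℝ) < (N + 1 : ℕ) := by positivity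
  have h1 := h (N + 1) hN1
  rw [le_div_iff₀ hNpos] at h1
  have h2 : K / |a| < (N + 1 : ℕ) := by push_cast; linarith
  rw [div_lt_iff₀ ha'] at h2
  linarith [mul_comm |a| ((N + 1 : ℕ) : ℝ)]

/-! ## Step 2: homomorphisms `ℝ/mℤ → ℝ/ℤ` obeying a tolerance inequality are `x ↦ n x/m`

This is the content of "`\widehat{ℝ/ℤ} = ℤ`" used in the proof of Thm. 5.3 together with the automatic
continuity of Prop. 5.2 (i) ("`|x| ≤ λ/n ⇒ |χ(x)| ≤ μ/n`, and hence that `χ` is uniformly continuous"),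
proved here from scratch (Mathlib has no Pontryagin dual of the circle). -/

section Classification

variable {m lam mu : ℝ} (χ : AddCircle m →+ AddCircle (1 : ℝ))

/-- The single-character tolerance hypothesis (the `j`-th slice of `IsTolHom`). [folklore] -/
private def Tol (χ : AddCircle m →+ AddCircle (1 : ℝ)) (lam mu : ℝ) : Prop :=
  ∀ (l : ℕ) (x : Fin l → AddCircle m), ∑ i, ‖x i‖ ≤ lam → ∑ i, ‖χ (x i)‖ ≤ mu

/-- "`|x| ≤ λ/M ⇒ |χ(x)| ≤ μ/M`" (proof of Prop. 5.2 (i): repeat the same element `M` times).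
[cite: ConnesConsani2023RiemannRoch, proof of Prop. 5.2 (i) p. 12] -/
private theorem norm_apply_coe_le {χ : AddCircle m →+ AddCircle (1 : ℝ)} (hχ : Tol χ lam mu)
    {M : ℕ} (hM : 1 ≤ M) {t : ℝ} (ht : |t| ≤ lam / M) : ‖χ (t : AddCircle m)‖ ≤ mu / M := by
  have hMpos : (0 : ℝ) < M := by exact_mod_cast hM
  have hsum : ∑ _i : Fin M, ‖(t : AddCircle m)‖ ≤ lam := by
    rw [Finset.sum_const, Finset.card_univ, Fintype.card_fin, nsmul_eq_mul]
    calc (M : ℝ) * ‖(t : AddCircle m)‖ ≤ M * |t| := by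
          gcongr; exact norm_coe_le_abs m t
      _ ≤ M * (lam / M) := by gcongr
      _ = lam := by field_simp
  have h := hχ M (fun _ => (t : AddCircle m)) hsum
  rw [Finset.sum_const, Finset.card_univ, Fintype.card_fin, nsmul_eq_mul] at h
  rw [le_div_iff₀ hMpos, mul_comm]
  exact h

/-- With `M = 1`: `|t| ≤ λ ⇒ ‖χ(t)‖ ≤ μ`. [folklore] -/
private theorem norm_apply_coe_le_one {χ : AddCircle m →+ AddCircle (1 : ℝ)} (hχ : Tol χ lam mu)
    {t : ℝ} (ht : |t| ≤ lam) : ‖χ (t : AddCircle m)‖ ≤ mu := by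
  have h := norm_apply_coe_le hχ (M := 1) le_rfl (t := t) (by simpa using ht)
  simpa using h

/-- The lifted character `ℓ(t) :=` representative of `χ(t mod m)` in `[−1/2, 1/2)`. [folklore] -/
private def ell (χ : AddCircle m →+ AddCircle (1 : ℝ)) (t : ℝ) : ℝ :=
  lift1 (χ (t : AddCircle m))

/-- `|ℓ(t)| = ‖χ(t)‖`. [folklore] -/
private theorem abs_ell_eq (t : ℝ) : |ell χ t| = ‖χ (t : AddCircle m)‖ :=
  (norm_eq_abs_lift1 _).symm

/-- `ℓ(0) = 0`. [folklore] -/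
private theorem ell_zero : ell χ 0 = 0 := by
  simp [ell, lift1_zero]

/-- Local additivity of `ℓ` on `[−λ, λ]` (for `μ ≤ 1/4`). [folklore] -/
private theorem ell_add {χ : AddCircle m →+ AddCircle (1 : ℝ)} (hχ : Tol χ lam mu) (hmu : mu ≤ 1 / 4)
    {s t : ℝ} (hs : |s| ≤ lam) (ht : |t| ≤ lam) (hst : |s + t| ≤ lam) :
    ell χ (s + t) = ell χ s + ell χ t := by
  unfold ell
  rw [AddCircle.coe_add, map_add]
  exact lift1_add_of_small ((norm_apply_coe_le_one hχ hs).trans hmu)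
    ((norm_apply_coe_le_one hχ ht).trans hmu)
    (by rw [← map_add, ← AddCircle.coe_add]; exact (norm_apply_coe_le_one hχ hst).trans hmu)

/-- `ℓ(−t) = −ℓ(t)` for `|t| ≤ λ`. [folklore] -/
private theorem ell_neg {χ : AddCircle m →+ AddCircle (1 : ℝ)} (hχ : Tol χ lam mu) (hmu : mu ≤ 1 / 4)
    {t : ℝ} (ht : |t| ≤ lam) : ell χ (-t) = -ell χ t := by
  have hlam : 0 ≤ lam := (abs_nonneg t).trans ht
  have h := ell_add hχ hmu ht (by rwa [abs_neg]) (by simp [hlam])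
  rw [add_neg_cancel, ell_zero] at h
  linarith

/-- `ℓ(j u) = j ℓ(u)` for `j ≤ N` when `|u| ≤ λ/N` (all partial sums stay in `[−λ, λ]`). [folklore] -/
private theorem ell_nat_mul {χ : AddCircle m →+ AddCircle (1 : ℝ)} (hχ : Tol χ lam mu)
    (hmu : mu ≤ 1 / 4) {N : ℕ} (hN : 1 ≤ N) {u : ℝ} (hu : |u| ≤ lam / N) :
    ∀ j : ℕ, j ≤ N → ell χ (j * u) = j * ell χ u := by
  have hNpos : (0 : ℝ) < N := by exact_mod_cast hN
  have hlam : 0 ≤ lam := by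
    have : 0 ≤ lam / N := (abs_nonneg u).trans hu
    exact (div_nonneg_iff.mp this).elim (fun h => h.1) fun h => by linarith [h.2]
  have hju : ∀ j : ℕ, j ≤ N → |(j : ℝ) * u| ≤ lam := fun j hj => by
    rw [abs_mul, Nat.abs_cast]
    calc (j : ℝ) * |u| ≤ N * |u| := mul_le_mul_of_nonneg_right (by exact_mod_cast hj) (abs_nonneg u)
      _ ≤ N * (lam / N) := mul_le_mul_of_nonneg_left hu hNpos.le
      _ = lam := by field_simp
  intro j hj
  induction j with
  | zero => simp [ell_zero]
  | succ j ih =>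
    have hj' : j ≤ N := Nat.le_of_succ_le hj
    have h1 := hju j hj'
    have h2 : |u| ≤ lam := by simpa using hju 1 hN
    have h3 : |(j : ℝ) * u + u| ≤ lam := by
      have := hju (j + 1) hj
      push_cast at this
      rwa [add_mul, one_mul] at this
    rw [Nat.cast_succ, add_mul, one_mul, ell_add hχ hmu h1 h2 h3, ih hj']
    ring

/-- `ℓ` is linear on `[0, λ/2]`: `ℓ(t) = c t` with `c = ℓ(λ/2)/(λ/2)` (grid squeeze). [folklore] -/
private theorem ell_eq_mul_of_nonneg {χ : AddCircle m →+ AddCircle (1 : ℝ)} (hχ : Tol χ lam mu)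
    (hmu : mu ≤ 1 / 4) (hlam : 0 < lam) {t : ℝ} (ht0 : 0 ≤ t) (ht : t ≤ lam / 2) :
    ell χ t = ell χ (lam / 2) / (lam / 2) * t := by
  set T : ℝ := lam / 2 with hT
  have hTpos : 0 < T := by positivity
  set c : ℝ := ell χ T / T with hc
  have hmu0 : 0 ≤ mu := le_trans (norm_nonneg _) (norm_apply_coe_le_one hχ (t := 0) (by simp [hlam.le]))
  -- squeeze
  have key : ∀ N : ℕ, 1 ≤ N → |ell χ t - c * t| ≤ ((mu + |c| * lam) / 2) / N := by
    intro N hN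
    have hNpos : (0 : ℝ) < N := by exact_mod_cast hN
    set u : ℝ := T / N with hu
    have hupos : 0 < u := by positivity
    have huabs : |u| ≤ lam / N := by
      rw [abs_of_pos hupos, hu, hT]
      rw [div_div]
      apply div_le_div_of_nonneg_left hlam.le hNpos
      linarith
    -- the grid point below t
    set j : ℕ := ⌊t / u⌋₊ with hj
    have hjle : (j : ℝ) ≤ t / u := Nat.floor_le (div_nonneg ht0 hupos.le)
    have hjlt : t / u < j + 1 := Nat.lt_floor_add_one (t / u)
    have hjN : j ≤ N := by
      have : (j : ℝ) ≤ N := by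
        calc (j : ℝ) ≤ t / u := hjle
          _ ≤ T / u := by gcongr
          _ = N := by rw [hu]; field_simp
      exact_mod_cast this
    set r : ℝ := t - j * u with hr
    have hr0 : 0 ≤ r := by
      rw [hr]; have := (le_div_iff₀ hupos).mp hjle; linarith
    have hru : r ≤ u := by
      rw [hr]; have := (div_lt_iff₀ hupos).mp hjlt; linarith
    -- decompose ℓ t = j ℓ u + ℓ r
    have hsplit : ell χ t = j * ell χ u + ell χ r := by
      have ht' : t = j * u + r := by rw [hr]; ring
      have h1 : |(j : ℝ) * u| ≤ lam := by
        rw [abs_of_nonneg (by positivity)]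
        calc (j : ℝ) * u ≤ N * u := mul_le_mul_of_nonneg_right (by exact_mod_cast hjN) hupos.le
          _ = T := by rw [hu]; field_simp
          _ ≤ lam := by linarith
      have h2 : |r| ≤ lam := by
        rw [abs_of_nonneg hr0]
        calc r ≤ u := hru
          _ ≤ lam / N := by rw [abs_of_pos hupos] at huabs; exact huabs
          _ ≤ lam := div_le_self hlam.le (by exact_mod_cast hN)
      have h3 : |(j : ℝ) * u + r| ≤ lam := by
        rw [← ht', abs_of_nonneg ht0]; linarith
      rw [ht', ell_add hχ hmu h1 h2 h3, ell_nat_mul hχ hmu hN huabs j hjN]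
      -- remaining: r named via ht'... (t rewritten)
    have hT' : ell χ T = N * ell χ u := by
      have := ell_nat_mul hχ hmu hN huabs N le_rfl
      rw [show (N : ℝ) * u = T by rw [hu]; field_simp] at this
      exact this
    have hcju : c * (j * u) = j * ell χ u := by
      have hTu : T = N * u := by rw [hu]; field_simp
      have hNu : (N : ℝ) * u ≠ 0 := mul_ne_zero hNpos.ne' hupos.ne'
      rw [hc, hT', hTu, div_mul_eq_mul_div, div_eq_iff hNu]
      ring
    have hdiff : ell χ t - c * t = ell χ r - c * r := by
      have ht' : t = j * u + r := by rw [hr]; ring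
      rw [hsplit, ht', mul_add, hcju]; ring
    rw [hdiff]
    have hlr : |ell χ r| ≤ mu / (2 * N : ℕ) := by
      rw [abs_ell_eq]
      refine norm_apply_coe_le hχ (M := 2 * N) (by omega) ?_
      rw [abs_of_nonneg hr0]
      calc r ≤ u := hru
        _ = lam / (2 * N : ℕ) := by rw [hu, hT]; push_cast; ring
    have hcr : |c * r| ≤ |c| * (lam / (2 * N)) := by
      rw [abs_mul]
      gcongr
      rw [abs_of_nonneg hr0]
      calc r ≤ u := hru
        _ = lam / (2 * N) := by rw [hu, hT]; ring
    calc |ell χ r - c * r| ≤ |ell χ r| + |c * r| := abs_sub _ _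
      _ ≤ mu / (2 * N : ℕ) + |c| * (lam / (2 * N)) := add_le_add hlr hcr
      _ = (mu + |c| * lam) / 2 / N := by push_cast; ring
  have := eq_zero_of_abs_le_div_nat key
  linarith

/-- `ℓ(t) = c t` on `[−λ/2, λ/2]`. [folklore] -/
private theorem ell_eq_mul {χ : AddCircle m →+ AddCircle (1 : ℝ)} (hχ : Tol χ lam mu)
    (hmu : mu ≤ 1 / 4) (hlam : 0 < lam) {t : ℝ} (ht : |t| ≤ lam / 2) :
    ell χ t = ell χ (lam / 2) / (lam / 2) * t := by
  rcases le_or_gt 0 t with ht0 | ht0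
  · exact ell_eq_mul_of_nonneg hχ hmu hlam ht0 ((le_abs_self t).trans ht)
  · have ht' : -t ≤ lam / 2 := by rw [abs_of_neg ht0] at ht; exact ht
    have hneg := ell_eq_mul_of_nonneg hχ hmu hlam (by linarith : (0 : ℝ) ≤ -t) ht'
    rw [ell_neg hχ hmu (ht.trans (by linarith))] at hneg
    linarith

/-- **Classification** (the "`Â = ℤ`" step of the proof of Thm. 5.3 with the automatic continuity of
Prop. 5.2 (i)): a homomorphism `χ : ℝ/mℤ → ℝ/ℤ` obeying the tolerance inequality for some `λ > 0`,
`μ ≤ 1/4` is `x ↦ n x/m` for an integer `n`. [cite: ConnesConsani2023RiemannRoch, proof of Thm. 5.3 p. 12] -/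
theorem exists_int_of_tol (hm : 0 < m) (hlam : 0 < lam) (hmu : mu ≤ 1 / 4)
    (hχ : ∀ (l : ℕ) (x : Fin l → AddCircle m), ∑ i, ‖x i‖ ≤ lam → ∑ i, ‖χ (x i)‖ ≤ mu) :
    ∃ n : ℤ, ∀ x : ℝ, χ (x : AddCircle m) = ((n * x / m : ℝ) : AddCircle (1 : ℝ)) := by
  have hχ' : Tol χ lam mu := hχ
  set c : ℝ := ell χ (lam / 2) / (lam / 2) with hc
  -- χ(x) = c x (mod 1) for all x
  have hall : ∀ x : ℝ, χ (x : AddCircle m) = ((c * x : ℝ) : AddCircle (1 : ℝ)) := by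
    intro x
    obtain ⟨N, hN⟩ := exists_nat_ge (|x| / (lam / 2))
    set N' : ℕ := N + 1 with hN'
    have hN'pos : (0 : ℝ) < N' := by positivity
    have hsmall : |x / N'| ≤ lam / 2 := by
      rw [abs_div, Nat.abs_cast, div_le_iff₀ hN'pos]
      have : |x| / (lam / 2) ≤ N' := hN.trans (by rw [hN']; push_cast; linarith)
      rwa [div_le_iff₀ (by positivity : (0:ℝ) < lam / 2), mul_comm] at this
    have hx : (x : AddCircle m) = N' • ((x / N' : ℝ) : AddCircle m) := by
      rw [← AddCircle.coe_nsmul, nsmul_eq_mul]; congr 1; field_simp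
    rw [hx, map_nsmul, ← coe_lift1 (χ _), ← AddCircle.coe_nsmul]
    change (((N' : ℕ) • ell χ (x / N') : ℝ) : AddCircle (1 : ℝ)) = _
    rw [ell_eq_mul hχ' hmu hlam hsmall, nsmul_eq_mul, ← hc]
    congr 1; field_simp
  -- c m ∈ ℤ from χ(m) = χ(0) = 0
  have hcm : ((c * m : ℝ) : AddCircle (1 : ℝ)) = 0 := by
    rw [← hall m, AddCircle.coe_period, map_zero]
  obtain ⟨n, hn⟩ := (AddCircle.coe_eq_zero_iff (1 : ℝ)).mp hcm
  rw [zsmul_eq_mul, mul_one] at hn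
  refine ⟨n, fun x => ?_⟩
  rw [hall x]
  congr 1
  rw [hn]; field_simp

end Classification

/-! ## Step 3: for `χ_j(x) = n_j x/m` the tolerance inequality is `Σ_j |n_j| ≤ μ m/λ` (proof of Thm. 5.3) -/

section Bound

variable {m lam mu : ℝ}

/-- "Assume that `Σ_j |n_j| ≤ 1/(4λ)` [here `μ m/λ`], then [the tolerance inequality] follows since
`d(n x, 0) ≤ |n| d(x, 0)`" (proof of Thm. 5.3, p. 12). [cite: ConnesConsani2023RiemannRoch, proof of Thm. 5.3 p. 12] -/
private theorem tol_of_sum_le (hm : 0 < m) (hlam : 0 < lam) {k : ℕ} (n : Fin k → ℤ)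
    (χ : Fin k → (AddCircle m →+ AddCircle (1 : ℝ)))
    (hχ : ∀ j (x : ℝ), χ j (x : AddCircle m) = ((n j * x / m : ℝ) : AddCircle (1 : ℝ)))
    (hn : ∑ j, |(n j : ℝ)| ≤ mu * m / lam) :
    ∀ (l : ℕ) (x : Fin l → AddCircle m), ∑ i, ‖x i‖ ≤ lam → ∑ i, ∑ j, ‖χ j (x i)‖ ≤ mu := by
  intro l x hx
  choose r hr using fun i => exists_rep hm (x i)
  have hsum_r : ∑ i, |r i| ≤ lam := by
    calc ∑ i, |r i| = ∑ i, ‖x i‖ := Finset.sum_congr rfl fun i _ => ((hr i).2.1).symm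
      _ ≤ lam := hx
  have hr0 : 0 ≤ ∑ i, |r i| := Finset.sum_nonneg fun i _ => abs_nonneg _
  have hmu : 0 ≤ mu := by
    have h0 : 0 ≤ mu * m / lam := (Finset.sum_nonneg fun j _ => abs_nonneg _).trans hn
    have := mul_nonneg h0 (div_nonneg hlam.le hm.le)
    calc (0 : ℝ) ≤ mu * m / lam * (lam / m) := this
      _ = mu := by field_simp
  calc ∑ i, ∑ j, ‖χ j (x i)‖ ≤ ∑ i, ∑ j, |(n j : ℝ)| * |r i| / m := by
        refine Finset.sum_le_sum fun i _ => Finset.sum_le_sum fun j _ => ?_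
        rw [← (hr i).1, hχ j]
        calc ‖((n j * r i / m : ℝ) : AddCircle (1 : ℝ))‖ ≤ |(n j : ℝ) * r i / m| :=
              norm_coe_le_abs 1 _
          _ = |(n j : ℝ)| * |r i| / m := by rw [abs_div, abs_mul, abs_of_pos hm]
    _ = (∑ j, |(n j : ℝ)|) * (∑ i, |r i|) / m := by
        rw [Finset.sum_mul_sum, Finset.sum_div, Finset.sum_comm]
        refine Finset.sum_congr rfl fun j _ => ?_
        rw [Finset.sum_div]
    _ ≤ (mu * m / lam) * lam / m := by
        have h1 : (∑ j, |(n j : ℝ)|) * (∑ i, |r i|) ≤ (mu * m / lam) * lam :=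
          mul_le_mul hn hsum_r hr0 (div_nonneg (mul_nonneg hmu hm.le) hlam.le)
        exact div_le_div_of_nonneg_right h1 hm.le
    _ = mu := by field_simp

/-- "Conversely … repeating `M` times the same `x` … Taking `M` large enough and `x = λ/M` one obtains
`Σ_j |n_j| x ≤ 1/(4M)`, and hence `Σ_j |n_j| ≤ 1/(4λ)` [here `μ m/λ`]" (proof of Thm. 5.3, p. 12 L62 –
p. 13 L5). [cite: ConnesConsani2023RiemannRoch, proof of Thm. 5.3 pp. 12–13] -/
private theorem sum_le_of_tol (hm : 0 < m) (hlam : 0 < lam) {k : ℕ} (n : Fin k → ℤ)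
    (χ : Fin k → (AddCircle m →+ AddCircle (1 : ℝ)))
    (hχ : ∀ j (x : ℝ), χ j (x : AddCircle m) = ((n j * x / m : ℝ) : AddCircle (1 : ℝ)))
    (htol : ∀ (l : ℕ) (x : Fin l → AddCircle m), ∑ i, ‖x i‖ ≤ lam → ∑ i, ∑ j, ‖χ j (x i)‖ ≤ mu) :
    ∑ j, |(n j : ℝ)| ≤ mu * m / lam := by
  set S : ℝ := ∑ j, |(n j : ℝ)| with hS
  have hS0 : 0 ≤ S := Finset.sum_nonneg fun j _ => abs_nonneg _
  obtain ⟨M₀, hM₀⟩ := exists_nat_ge (2 * S * lam / m)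
  set M : ℕ := M₀ + 1 with hM
  have hM1 : 1 ≤ M := Nat.le_add_left 1 M₀
  have hMpos : (0 : ℝ) < M := by positivity
  have hMge : 2 * S * lam / m ≤ M := hM₀.trans (by rw [hM]; push_cast; linarith)
  set t : ℝ := lam / M with ht
  have htpos : 0 < t := by positivity
  have hx : ∑ _i : Fin M, ‖(t : AddCircle m)‖ ≤ lam := by
    rw [Finset.sum_const, Finset.card_univ, Fintype.card_fin, nsmul_eq_mul]
    calc (M : ℝ) * ‖(t : AddCircle m)‖ ≤ M * |t| := by
          gcongr; exact norm_coe_le_abs m t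
      _ = lam := by rw [abs_of_pos htpos, ht]; field_simp
  have h := htol M (fun _ => (t : AddCircle m)) hx
  rw [Finset.sum_const, Finset.card_univ, Fintype.card_fin, nsmul_eq_mul] at h
  have hsmall : ∀ j, |(n j : ℝ)| * t / m ≤ 1 / 2 := by
    intro j
    have hj : |(n j : ℝ)| ≤ S := by
      rw [hS]
      exact Finset.single_le_sum (f := fun j' => |(n j' : ℝ)|) (fun j' _ => abs_nonneg _)
        (Finset.mem_univ j)
    calc |(n j : ℝ)| * t / m ≤ S * t / m := by gcongr
      _ = (2 * S * lam / m) / (2 * M) := by rw [ht]; field_simp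
      _ ≤ (M : ℝ) / (2 * M) := by gcongr
      _ = 1 / 2 := by field_simp
  have hterm : ∀ j, ‖χ j (t : AddCircle m)‖ = |(n j : ℝ)| * t / m := by
    intro j
    have habs : |(n j : ℝ) * t / m| = |(n j : ℝ)| * t / m := by
      rw [abs_div, abs_mul, abs_of_pos htpos, abs_of_pos hm]
    rw [hχ j t, (AddCircle.norm_coe_eq_abs_iff (1 : ℝ) one_ne_zero).mpr, habs]
    rw [habs, abs_one]
    exact hsmall j
  rw [Finset.sum_congr rfl fun j _ => hterm j] at h
  have hMS : (M : ℝ) * ∑ j, |(n j : ℝ)| * t / m = S * lam / m := by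
    rw [← Finset.sum_div, ← Finset.sum_mul, ← hS, ht]
    field_simp
  rw [hMS, div_le_iff₀ hm] at h
  rw [le_div_iff₀ hlam]
  linarith

end Bound

/-! ## Theorem 5.3 = Theorem 1.2 (Serre duality), level by level -/

/-- Sum bookkeeping: for `y_j = n_j·(4/m)`, `Σ|y_j| ≤ e^{−a} ⟺ Σ|n_j| ≤ (1/4)·m/e^{a}`. [folklore] -/
private theorem sum_abs_lattice_iff {m a : ℝ} (hm : 0 < m) {k : ℕ} (n : Fin k → ℤ) :
    ∑ j, |(n j : ℝ) * (4 / m)| ≤ Real.exp (-a) ↔ ∑ j, |(n j : ℝ)| ≤ 1 / 4 * m / Real.exp a := by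
  have h4m : 0 < 4 / m := by positivity
  have hea : 0 < Real.exp a := Real.exp_pos a
  have hrw : ∑ j, |(n j : ℝ) * (4 / m)| = (∑ j, |(n j : ℝ)|) * (4 / m) := by
    rw [Finset.sum_mul]
    exact Finset.sum_congr rfl fun j _ => by rw [abs_mul, abs_of_pos h4m]
  rw [hrw, Real.exp_neg]
  constructor
  · intro h
    rw [le_div_iff₀ hea]
    have := mul_le_mul_of_nonneg_right h (by positivity : (0 : ℝ) ≤ m / 4 * Real.exp a)
    calc (∑ j, |(n j : ℝ)|) * Real.exp a
        = (∑ j, |(n j : ℝ)|) * (4 / m) * (m / 4 * Real.exp a) := by field_simp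
      _ ≤ (Real.exp a)⁻¹ * (m / 4 * Real.exp a) := this
      _ = 1 / 4 * m := by field_simp
  · intro h
    rw [le_div_iff₀ hea] at h
    have := mul_le_mul_of_nonneg_right h (by positivity : (0 : ℝ) ≤ 4 / m * (Real.exp a)⁻¹)
    calc (∑ j, |(n j : ℝ)|) * (4 / m)
        = (∑ j, |(n j : ℝ)|) * Real.exp a * (4 / m * (Real.exp a)⁻¹) := by field_simp
      _ ≤ 1 / 4 * m * (4 / m * (Real.exp a)⁻¹) := this
      _ = (Real.exp a)⁻¹ := by field_simp

/-- **Connes–Consani 2023, Theorem 5.3 = Theorem 1.2 (Serre duality for `\overline{Spec ℤ}`), at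
level `k_+`** (PROVED).  For every Arakelov divisor `D` (lattice `L_D = mℤ`, `m = gen D`, `H¹(D) =
(ℝ/mℤ, d)_{e^a}`) and every `k`-tuple `(χ_j)` of homomorphisms `ℝ/mℤ → ℝ/ℤ`: `(χ_j)` belongs to
`Hom_{Γ𝒯*}(H¹(D), U(1)_{1/4})(k_+)` (Prop. 5.2 (i): `Σ_i|x_i| ≤ e^a ⇒ Σ_{i,j}|χ_j(x_i)| ≤ 1/4`) if and
only if `χ_j = χ_{y_j}` (`x ↦ x y_j/4`) for a `k`-tuple `(y_j) ∈ H⁰(K − D)(k_+)`, i.e. `y_j ∈ L_{K−D} =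
(4/m)ℤ` with `Σ_j |y_j| ≤ e^{−a}`; `K = −2{2}`.  The `y` is unique (`dualChar_injOn`), so this is a
bijection `H⁰(K − D)(k_+) ≃ Hom_{Γ𝒯*}(H¹(D), U(1)_{1/4})(k_+)` at every level (`serreDualityEquiv`), which
is the printed isomorphism of `𝕊[±1]`-modules read levelwise.
[cite: ConnesConsani2023RiemannRoch, Thm. 5.3 p. 12 (= Thm. 1.2 p. 4)] -/
theorem serreDuality_level (D : ArakelovDivisor) (k : ℕ)
    (χ : Fin k → (AddCircle D.gen →+ AddCircle (1 : ℝ))) :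
    IsTolHom (Real.exp D.inf) (1 / 4) χ ↔
      ∃ y ∈ H0Level (canonicalDivisor.sub D) k, ∀ j, χ j = dualChar D (y j) := by
  have hm := D.gen_pos
  have hlam := Real.exp_pos D.inf
  constructor
  · intro hχ
    have hn : ∀ j, ∃ n : ℤ, ∀ x : ℝ,
        χ j (x : AddCircle D.gen) = ((n * x / D.gen : ℝ) : AddCircle (1 : ℝ)) := by
      intro j
      refine exists_int_of_tol (χ j) hm hlam le_rfl fun l x hx => ?_
      refine le_trans (Finset.sum_le_sum fun i _ => ?_) (hχ l x hx)
      exact Finset.single_le_sum (f := fun j' => ‖χ j' (x i)‖) (fun j' _ => norm_nonneg _)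
        (Finset.mem_univ j)
    choose n hn using hn
    have hS := sum_le_of_tol hm hlam n χ hn hχ
    have hyL : ∀ j, (n j : ℝ) * (4 / D.gen) ∈ (canonicalDivisor.sub D).lattice := fun j =>
      (mem_lattice_canonical_sub D _).mpr ⟨n j, rfl⟩
    refine ⟨fun j => n j * (4 / D.gen), ⟨hyL, ?_⟩, fun j => ?_⟩
    · rw [inf_canonical_sub]
      exact (sum_abs_lattice_iff hm n).mpr hS
    · refine AddMonoidHom.ext fun z => ?_
      induction z using QuotientAddGroup.induction_on with
      | H x =>
        change χ j (x : AddCircle D.gen) = dualChar D (n j * (4 / D.gen)) (x : AddCircle D.gen)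
        rw [hn j x, dualChar_apply_coe (hyL j)]
        congr 1
        field_simp
  · rintro ⟨y, ⟨hyL, hysum⟩, hχy⟩
    choose n hn using fun j => (mem_lattice_canonical_sub D (y j)).mp (hyL j)
    refine tol_of_sum_le hm hlam n χ (fun j x => ?_) ?_
    · rw [hχy j, dualChar_apply_coe (hyL j), hn j]
      congr 1
      field_simp
    · refine (sum_abs_lattice_iff hm n).mp ?_
      rw [← inf_canonical_sub D]
      calc ∑ j, |(n j : ℝ) * (4 / D.gen)| = ∑ j, |y j| :=
            Finset.sum_congr rfl fun j _ => by rw [← hn j]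
        _ ≤ Real.exp (canonicalDivisor.sub D).inf := hysum

/-- Uniqueness of the parameter: `y ↦ χ_y` is injective on `L_{K−D}` (two lattice characters agreeing
everywhere differ by `x ↦ (n−n')x/m ≡ 0`, impossible at `x = m/(2(n−n'))`). [folklore] -/
private theorem dualChar_injOn (D : ArakelovDivisor) :
    Set.InjOn (dualChar D) (canonicalDivisor.sub D).lattice := by
  intro y hy y' hy' h
  obtain ⟨n, hn⟩ := (mem_lattice_canonical_sub D y).mp hy
  obtain ⟨n', hn'⟩ := (mem_lattice_canonical_sub D y').mp hy'
  have hm := D.gen_pos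
  by_contra hne
  have hnn : n ≠ n' := by
    rintro rfl; exact hne (by rw [hn, hn'])
  have hd : ((n : ℝ) - n') ≠ 0 := by
    rw [sub_ne_zero]; exact_mod_cast hnn
  set x : ℝ := D.gen / (2 * (n - n')) with hx
  have h1 : dualChar D y (x : AddCircle D.gen) = dualChar D y' (x : AddCircle D.gen) := by rw [h]
  rw [dualChar_apply_coe hy, dualChar_apply_coe hy'] at h1
  have h2 : (((x * y / 4 - x * y' / 4 : ℝ)) : AddCircle (1 : ℝ)) = 0 := by
    rw [AddCircle.coe_sub, h1, sub_self]
  have h3 : x * y / 4 - x * y' / 4 = 1 / 2 := by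
    rw [hn, hn', hx]; field_simp
  rw [h3] at h2
  obtain ⟨q, hq⟩ := (AddCircle.coe_eq_zero_iff (1 : ℝ)).mp h2
  rw [zsmul_eq_mul, mul_one] at hq
  have : (2 * q : ℤ) = 1 := by exact_mod_cast (by rw [hq]; norm_num : (2 * q : ℝ) = 1)
  omega

/-- **Theorem 5.3 as a bijection at each level `k_+`**: `y ↦ (χ_{y_j})_j` is a bijection from
`H⁰(K − D)(k_+)` onto `Hom_{Γ𝒯*}(H¹(D), U(1)_{1/4})(k_+)`. [cite: ConnesConsani2023RiemannRoch, Thm. 5.3 p. 12] -/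
theorem dualChar_bijective (D : ArakelovDivisor) (k : ℕ) :
    Function.Bijective (fun y : H0Level (canonicalDivisor.sub D) k =>
      (⟨fun j => dualChar D (y.1 j), (serreDuality_level D k _).mpr ⟨y.1, y.2, fun _ => rfl⟩⟩ :
        {χ : Fin k → (AddCircle D.gen →+ AddCircle (1 : ℝ)) // IsTolHom (Real.exp D.inf) (1 / 4) χ})) := by
  constructor
  · rintro ⟨y, hy⟩ ⟨y', hy'⟩ h
    have h' : (fun j => dualChar D (y j)) = fun j => dualChar D (y' j) := congrArg Subtype.val h
    ext j
    exact dualChar_injOn D (hy.1 j) (hy'.1 j) (congrFun h' j)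
  · rintro ⟨χ, hχ⟩
    obtain ⟨y, hy, hχy⟩ := (serreDuality_level D k χ).mp hχ
    exact ⟨⟨y, hy⟩, Subtype.ext (funext fun j => (hχy j).symm)⟩

/-- The canonical bijection `H⁰(K − D)(k_+) ≃ Hom_{Γ𝒯*}(H¹(D), U(1)_{1/4})(k_+)` of Theorem 5.3.
[cite: ConnesConsani2023RiemannRoch, Thm. 5.3 p. 12 (= Thm. 1.2 p. 4)] -/
def serreDualityEquiv (D : ArakelovDivisor) (k : ℕ) :
    H0Level (canonicalDivisor.sub D) k ≃
      {χ : Fin k → (AddCircle D.gen →+ AddCircle (1 : ℝ)) // IsTolHom (Real.exp D.inf) (1 / 4) χ} :=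
  Equiv.ofBijective _ (dualChar_bijective D k)

/-- **Connes–Consani 2023, Theorem 5.3 = Theorem 1.2** as a named statement (house style of
`RiemannRochSpecZ.lean`): "Let `D` be an Arakelov divisor on `\overline{Spec ℤ}`. There is a canonical
isomorphism of `𝕊[±1]`-modules `H⁰(K − D) ≃ Hom_{Γ𝒯*}(H¹(D), U(1)_{1/4})`, where `K = −2{2}`", read at
every level `k_+` with Prop. 5.2 (i)'s description of the right-hand side.  DISCHARGED below.
[cite: ConnesConsani2023RiemannRoch, Thm. 5.3 p. 12 (= Thm. 1.2 p. 4)] -/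
def SerreDuality_SpecZbar : Prop :=
  ∀ (D : ArakelovDivisor) (k : ℕ) (χ : Fin k → (AddCircle D.gen →+ AddCircle (1 : ℝ))),
    IsTolHom (Real.exp D.inf) (1 / 4) χ ↔
      ∃ y ∈ H0Level (canonicalDivisor.sub D) k, ∀ j, χ j = dualChar D (y j)

/-- Theorem 5.3 holds (PROVED, following the printed proof). [cite: ConnesConsani2023RiemannRoch, Thm. 5.3 p. 12] -/
theorem SerreDuality_SpecZbar_holds : SerreDuality_SpecZbar :=
  fun D k χ => serreDuality_level D k χ

/-- The form displayed at the head of §5 (p. 11): "`H⁰(D) ≃ Hom_{Γ𝒯*}(H¹(K − D), U(1)_{1/4})`", i.e.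
Theorem 5.3 applied to `K − D`, using `K − (K − D) = D`. [cite: ConnesConsani2023RiemannRoch, §5 p. 11] -/
theorem serreDuality_level' (D : ArakelovDivisor) (k : ℕ)
    (χ : Fin k → (AddCircle (canonicalDivisor.sub D).gen →+ AddCircle (1 : ℝ))) :
    IsTolHom (Real.exp (canonicalDivisor.sub D).inf) (1 / 4) χ ↔
      ∃ y ∈ H0Level D k, ∀ j, χ j = dualChar (canonicalDivisor.sub D) (y j) := by
  have h := serreDuality_level (canonicalDivisor.sub D) k χ
  rwa [canonical_sub_canonical_sub] at h

/-- "One has `dim_{𝕊[±1]}(U(1)_{1/4}) = 1`" (§5 p. 11: the dualizing module has dimension one), from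
Prop. 4.1 PROVED in `RiemannRochSpecZProofs` (`dim_U1_eq_holds`):
`⌈(−log(1/4) − log 2)/log 3⌉ = ⌈log 2/log 3⌉ = 1`. [cite: ConnesConsani2023RiemannRoch, §5 p. 11] -/
theorem pmTolDim_U1_quarter : pmTolDim (AddCircle (1 : ℝ)) (1 / 4) = 1 := by
  have h := (dim_U1_eq_holds (1 / 4) (by norm_num)).1 (by norm_num)
  have hlog : (-Real.log (1 / 4) - Real.log 2) / Real.log 3 = Real.log 2 / Real.log 3 := by
    rw [one_div, Real.log_inv, show (4 : ℝ) = 2 ^ 2 by norm_num, Real.log_pow]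
    push_cast
    ring
  have h2 : 0 < Real.log 2 := Real.log_pos (by norm_num)
  have h3 : Real.log 2 ≤ Real.log 3 := Real.log_le_log (by norm_num) (by norm_num)
  have h3' : 0 < Real.log 3 := h2.trans_le h3
  have hceil : ⌈Real.log 2 / Real.log 3⌉ = (1 : ℤ) := by
    rw [Int.ceil_eq_iff]
    push_cast
    constructor
    · linarith [div_pos h2 h3']
    · exact (div_le_one h3').mpr h3
  rw [hlog, hceil] at h
  exact_mod_cast h

end Literature.NumberTheory.ConnesConsani2023

end
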